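import Literature.Computability.Complexity.CodeFPBudgets
import Literature.Computability.Complexity.CodeFPInvFolds
import Mathlib.NumberTheory.LegendreSymbol.JacobiSymbol
import HarnessLib

/-!
# Stub `stub_jacobiSymCodeFP` (line `Sketch`, crux `MobiusLadder.LiouvilleNotPPoly`)

The Jacobi symbol `(a | b)` (`a : ℤ`, `b : ℕ`, Mathlib's `jacobiSym`, defined for every `b`) is
computed on codes by a polynomial-time string function, in the tree's typed model
`CodeFP (pairE intE natE) intE`.

Algorithm (binary/Euclid-type Jacobi algorithm). State `(a, n, t) : ℕ × ℕ × ℤ`, started at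
`((a mod b).toNat, b, 1)` (`(0, 1, 1)` when `b = 0`, where `(a | 0) = 1`), with the invariant
`n ≠ 0`, `a < n`, `t · (a | n) = (a₀ | b)`. One round `F`: frozen once `a = 0`; for even `n`,
`(a | 2n') = (a | 2) (a mod n' | n')` with `(a | 2) = [a odd]`; for odd `n` and even `a`, the
second supplement (`jacobiSym.even_odd`); for odd `a, n`, reciprocity and reduction
(`jacobiSym.quadratic_reciprocity_if`, `jacobiSym.mod_left`). The potential `size a + 2 size n`
drops every productive round, so `3 · size b` rounds (a unary budget read off the input) reach
`a = 0`, where the answer is `t` if `n = 1` and `0` otherwise. No entry ever grows in size and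
`|t| ≤ 1`, which is the polynomial accumulator bound of the iteration combinator
`CodeFP.iterateInv`. The round is handled through its four defining branches (hypotheses
`h0`–`h3` on a step function `F`), instantiated by the explicit `if`-cascade in the final theorem.
-/

set_option linter.dupNamespace false -- D-0017: single-problem summit ⇒ `QuantumAdvantage.QuantumAdvantage` by design

namespace Summit.QuantumAdvantage.QuantumAdvantage.Theorems.LiouvilleNotPPoly

namespace JacobiCodeFP

open _root_.Computability Literature.Computability.Complexity
  Literature.Computability.Complexity.CodeFP Polynomial

/-! ### Arithmetic of one round -/

/-- `(a | 2) = [a odd]` for a natural number `a`. -/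
theorem jacobiSym_two_right (a : ℕ) : jacobiSym (a : ℤ) 2 = if a % 2 = 0 then 0 else 1 := by
  rw [jacobiSym.mod_left]
  by_cases h : a % 2 = 0
  · have h' : (a : ℤ) % ((2 : ℕ) : ℤ) = 0 := by push_cast; omega
    rw [h', if_pos h]
    exact jacobiSym.zero_left (by norm_num)
  · have h' : (a : ℤ) % ((2 : ℕ) : ℤ) = 1 := by push_cast; omega
    rw [h', if_neg h]
    exact jacobiSym.one_left 2

/-- Peeling a factor `2` off an even bottom argument: `(a | n) = (a | 2) · (a mod n/2 | n/2)`. -/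
theorem jacobiSym_even_right (a : ℕ) {n : ℕ} (hn : n % 2 = 0) (hn0 : n ≠ 0) :
    jacobiSym (a : ℤ) n =
      (if a % 2 = 0 then 0 else 1) * jacobiSym ((a % (n / 2) : ℕ) : ℤ) (n / 2) := by
  have h2 : n / 2 ≠ 0 := by omega
  conv_lhs => rw [← Nat.mul_div_cancel' (Nat.dvd_of_mod_eq_zero hn)]
  rw [jacobiSym.mul_right' _ two_ne_zero h2, jacobiSym_two_right,
    jacobiSym.mod_left (a : ℤ) (n / 2), Int.natCast_emod]

/-- Halving drops the size. -/
theorem size_div_two_lt {a : ℕ} (ha : a ≠ 0) : Nat.size (a / 2) < Nat.size a := by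
  have h1 : 0 < Nat.size a := Nat.size_pos.2 (Nat.pos_of_ne_zero ha)
  have h2 : a < 2 ^ Nat.size a := Nat.lt_size_self a
  have h3 : 2 ^ Nat.size a = 2 * 2 ^ (Nat.size a - 1) := by
    rw [← pow_succ']; congr 1; omega
  have h4 : Nat.size (a / 2) ≤ Nat.size a - 1 := Nat.size_le.2 (by omega)
  omega

/-- The swap step drops the potential: `size (n mod a) + size a < 2 size n` for `0 < a < n`. -/
theorem size_mod_add_size_lt {a n : ℕ} (ha : a ≠ 0) (han : a < n) :
    Nat.size (n % a) + Nat.size a < 2 * Nat.size n := by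
  have hsa : Nat.size a ≤ Nat.size n := Nat.size_le_size han.le
  have hr : n % a < a := Nat.mod_lt n (Nat.pos_of_ne_zero ha)
  have hsr : Nat.size (n % a) ≤ Nat.size a := Nat.size_le_size hr.le
  rcases hsa.lt_or_eq with hlt | heq
  · omega
  · have k1 : 0 < Nat.size a := Nat.size_pos.2 (Nat.pos_of_ne_zero ha)
    have h2a : 2 ^ (Nat.size a - 1) ≤ a := Nat.lt_size.1 (by omega)
    have hn2 : n < 2 ^ Nat.size n := Nat.lt_size_self n
    have h3 : 2 ^ Nat.size n = 2 * 2 ^ (Nat.size n - 1) := by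
      rw [← pow_succ']; congr 1; omega
    have hmod : n % a + a ≤ n := by
      have h := Nat.mod_add_div n a
      have hq : 1 ≤ n / a := Nat.div_pos han.le (Nat.pos_of_ne_zero ha)
      nlinarith
    rw [heq] at h2a
    have h5 : Nat.size (n % a) ≤ Nat.size n - 1 := Nat.size_le.2 (by omega)
    omega

/-! ### The run: invariant, termination, correctness

A step function `F` on states `(a, n, t)` is specified by its branches: `h0` (frozen at `a = 0`),
`h1` (even `n`), `h2` (odd `n`, even `a`), `h3` (odd `a, n`). -/

/-- **One productive round** (`a ≠ 0`) keeps the invariant `n ≠ 0`, `a < n`, `t · (a | n) = R`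
and drops the potential `size a + 2 size n`. -/
theorem step_spec (F : ℕ × ℕ × ℤ → ℕ × ℕ × ℤ)
    (h1 : ∀ (a n : ℕ) (t : ℤ), a ≠ 0 → n % 2 = 0 →
      F (a, n, t) = (a % (n / 2), n / 2, if a % 2 = 0 then 0 else t))
    (h2 : ∀ (a n : ℕ) (t : ℤ), a ≠ 0 → n % 2 = 1 → a % 2 = 0 →
      F (a, n, t) = (a / 2, n, if n % 8 = 3 ∨ n % 8 = 5 then -t else t))
    (h3 : ∀ (a n : ℕ) (t : ℤ), a ≠ 0 → n % 2 = 1 → a % 2 = 1 →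
      F (a, n, t) = (n % a, a, if a % 4 = 3 ∧ n % 4 = 3 then -t else t))
    {R : ℤ} {a n : ℕ} {t : ℤ} (ha : a ≠ 0) (hn : n ≠ 0) (hlt : a < n)
    (ht : t * jacobiSym (a : ℤ) n = R) :
    ∃ (a' n' : ℕ) (t' : ℤ), F (a, n, t) = (a', n', t') ∧ n' ≠ 0 ∧ a' < n' ∧
      t' * jacobiSym (a' : ℤ) n' = R ∧
      Nat.size a' + 2 * Nat.size n' < Nat.size a + 2 * Nat.size n := by
  by_cases hne : n % 2 = 0
  · refine ⟨_, _, _, h1 a n t ha hne, by omega, Nat.mod_lt _ (by omega), ?_, ?_⟩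
    · rw [jacobiSym_even_right a hne hn] at ht
      rw [← ht]
      split_ifs <;> ring
    · have h4 := size_div_two_lt hn
      have h5 : Nat.size (a % (n / 2)) ≤ Nat.size a := Nat.size_le_size (Nat.mod_le a _)
      omega
  by_cases hae : a % 2 = 0
  · refine ⟨_, _, _, h2 a n t ha (by omega) hae, hn,
      lt_of_le_of_lt (Nat.div_le_self a 2) hlt, ?_, ?_⟩
    · have key := jacobiSym.even_odd (a := (a : ℤ)) (b := n) (by omega) (by omega)
      rw [show (a : ℤ) / 2 = ((a / 2 : ℕ) : ℤ) by omega] at key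
      rw [← ht, ← key]
      split_ifs <;> ring
    · have := size_div_two_lt ha
      omega
  · refine ⟨_, _, _, h3 a n t ha (by omega) (by omega), ha,
      Nat.mod_lt _ (Nat.pos_of_ne_zero ha), ?_, ?_⟩
    · have key := jacobiSym.quadratic_reciprocity_if (a := a) (b := n) (by omega) (by omega)
      rw [jacobiSym.mod_left (n : ℤ) a, ← Int.natCast_emod] at key
      rw [← ht, ← key]
      split_ifs <;> ring
    · have := size_mod_add_size_lt ha hlt
      omega

/-- **Termination and correctness of the run**: from a state with `n ≠ 0`, `a < n`,
`t · (a | n) = R`, any `k ≥ size a + 2 size n` rounds reach a state `(0, n', t')` with `n' ≠ 0`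
and `t' · (0 | n') = R`. -/
theorem iterate_spec (F : ℕ × ℕ × ℤ → ℕ × ℕ × ℤ)
    (h0 : ∀ (n : ℕ) (t : ℤ), F (0, n, t) = (0, n, t))
    (h1 : ∀ (a n : ℕ) (t : ℤ), a ≠ 0 → n % 2 = 0 →
      F (a, n, t) = (a % (n / 2), n / 2, if a % 2 = 0 then 0 else t))
    (h2 : ∀ (a n : ℕ) (t : ℤ), a ≠ 0 → n % 2 = 1 → a % 2 = 0 →
      F (a, n, t) = (a / 2, n, if n % 8 = 3 ∨ n % 8 = 5 then -t else t))
    (h3 : ∀ (a n : ℕ) (t : ℤ), a ≠ 0 → n % 2 = 1 → a % 2 = 1 →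
      F (a, n, t) = (n % a, a, if a % 4 = 3 ∧ n % 4 = 3 then -t else t)) (R : ℤ) :
    ∀ (k a n : ℕ) (t : ℤ), n ≠ 0 → a < n → t * jacobiSym (a : ℤ) n = R →
      Nat.size a + 2 * Nat.size n ≤ k →
      ∃ (n' : ℕ) (t' : ℤ),
        F^[k] (a, n, t) = (0, n', t') ∧ n' ≠ 0 ∧ t' * jacobiSym 0 n' = R
  | 0, a, n, t, hn, _, ht, hk => by
    have ha : a = 0 := Nat.size_eq_zero.1 (by omega)
    subst ha
    exact ⟨n, t, rfl, hn, by rwa [Nat.cast_zero] at ht⟩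
  | k + 1, a, n, t, hn, hlt, ht, hk => by
    by_cases ha : a = 0
    · subst ha
      exact ⟨n, t, Function.iterate_fixed (h0 n t) _, hn, by rwa [Nat.cast_zero] at ht⟩
    · obtain ⟨a', n', t', hs, hn', hlt', ht', hpot⟩ := step_spec F h1 h2 h3 ha hn hlt ht
      rw [Function.iterate_succ_apply, hs]
      exact iterate_spec F h0 h1 h2 h3 R k a' n' t' hn' hlt' ht' (by omega)

/-! ### Sizes along the run -/

/-- Rounds keep the size invariant `size a, size n ≤ M`, `|t| ≤ 1` (no entry grows in size). -/
theorem small_step (F : ℕ × ℕ × ℤ → ℕ × ℕ × ℤ)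
    (h0 : ∀ (n : ℕ) (t : ℤ), F (0, n, t) = (0, n, t))
    (h1 : ∀ (a n : ℕ) (t : ℤ), a ≠ 0 → n % 2 = 0 →
      F (a, n, t) = (a % (n / 2), n / 2, if a % 2 = 0 then 0 else t))
    (h2 : ∀ (a n : ℕ) (t : ℤ), a ≠ 0 → n % 2 = 1 → a % 2 = 0 →
      F (a, n, t) = (a / 2, n, if n % 8 = 3 ∨ n % 8 = 5 then -t else t))
    (h3 : ∀ (a n : ℕ) (t : ℤ), a ≠ 0 → n % 2 = 1 → a % 2 = 1 →
      F (a, n, t) = (n % a, a, if a % 4 = 3 ∧ n % 4 = 3 then -t else t))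
    {M : ℕ} {st : ℕ × ℕ × ℤ}
    (h : Nat.size st.1 ≤ M ∧ Nat.size st.2.1 ≤ M ∧ st.2.2.natAbs ≤ 1) :
    Nat.size (F st).1 ≤ M ∧ Nat.size (F st).2.1 ≤ M ∧ (F st).2.2.natAbs ≤ 1 := by
  obtain ⟨a, n, t⟩ := st
  obtain ⟨ha, hn, ht⟩ := h
  dsimp only at ha hn ht
  by_cases ha0 : a = 0
  · subst ha0; rw [h0]; exact ⟨ha, hn, ht⟩
  by_cases hne : n % 2 = 0
  · rw [h1 a n t ha0 hne]
    refine ⟨(Nat.size_le_size (Nat.mod_le _ _)).trans ha,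
      (Nat.size_le_size (Nat.div_le_self _ _)).trans hn, ?_⟩
    dsimp only; split_ifs
    · simp
    · exact ht
  by_cases hae : a % 2 = 0
  · rw [h2 a n t ha0 (by omega) hae]
    refine ⟨(Nat.size_le_size (Nat.div_le_self _ _)).trans ha, hn, ?_⟩
    dsimp only; split_ifs
    · rwa [Int.natAbs_neg]
    · exact ht
  · rw [h3 a n t ha0 (by omega) (by omega)]
    refine ⟨(Nat.size_le_size (Nat.mod_le _ _)).trans hn, ha, ?_⟩
    dsimp only; split_ifs
    · rwa [Int.natAbs_neg]
    · exact ht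

/-- The size invariant (with `M = size b + 1`) holds at the initial state `I (a, b)`
(`(0, 1, 1)` if `b = 0`, else `((a mod b).toNat, b, 1)`). -/
theorem small_init (I : ℤ × ℕ → ℕ × ℕ × ℤ)
    (hI : I = fun q =>
      if q.2 = 0 then ((0 : ℕ), (1 : ℕ), (1 : ℤ)) else ((q.1 % q.2).toNat, q.2, 1))
    (q : ℤ × ℕ) :
    Nat.size (I q).1 ≤ Nat.size q.2 + 1 ∧ Nat.size (I q).2.1 ≤ Nat.size q.2 + 1 ∧
      (I q).2.2.natAbs ≤ 1 := by
  subst hI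
  obtain ⟨a₀, n₀⟩ := q
  dsimp only
  by_cases hn0 : n₀ = 0
  · subst hn0
    simp
  · simp only [if_neg hn0]
    have hpos : (0 : ℤ) < n₀ := by exact_mod_cast Nat.pos_of_ne_zero hn0
    have h1 : 0 ≤ a₀ % n₀ := Int.emod_nonneg _ hpos.ne'
    have h2 : a₀ % n₀ < n₀ := Int.emod_lt_of_pos _ hpos
    have h3 : Nat.size (a₀ % n₀).toNat ≤ Nat.size n₀ := Nat.size_le_size (by omega)
    refine ⟨?_, ?_, ?_⟩ <;> omega

/-- Small states have short codes: `|code (a, n, t)| ≤ 4 (|code (a₀, b)| + j) + 16`. -/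
theorem length_le_of_small {q : ℤ × ℕ} {st : ℕ × ℕ × ℤ}
    (h : Nat.size st.1 ≤ Nat.size q.2 + 1 ∧ Nat.size st.2.1 ≤ Nat.size q.2 + 1 ∧
      st.2.2.natAbs ≤ 1) (j : ℕ) :
    (pairE natE (pairE natE intE) st).length ≤
      (4 * X + 16 : Polynomial ℕ).eval ((pairE intE natE q).length + j) := by
  obtain ⟨h1, h2, ht⟩ := h
  have h3 : (intE st.2.2).length ≤ 4 :=
    (length_intE_le_of_natAbs_le ht).trans (by rw [Nat.size_one])
  simp only [length_pairE, CodeFP.length_natE, eval_add, eval_mul, eval_X, eval_ofNat]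
  omega

/-! ### Polynomial time -/

/-- A round is computed on codes (the `if`-cascade of its branches, in the typed combinators). -/
theorem codeFP_step (F : ℕ × ℕ × ℤ → ℕ × ℕ × ℤ)
    (h0 : ∀ (n : ℕ) (t : ℤ), F (0, n, t) = (0, n, t))
    (h1 : ∀ (a n : ℕ) (t : ℤ), a ≠ 0 → n % 2 = 0 →
      F (a, n, t) = (a % (n / 2), n / 2, if a % 2 = 0 then 0 else t))
    (h2 : ∀ (a n : ℕ) (t : ℤ), a ≠ 0 → n % 2 = 1 → a % 2 = 0 →
      F (a, n, t) = (a / 2, n, if n % 8 = 3 ∨ n % 8 = 5 then -t else t))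
    (h3 : ∀ (a n : ℕ) (t : ℤ), a ≠ 0 → n % 2 = 1 → a % 2 = 1 →
      F (a, n, t) = (n % a, a, if a % 4 = 3 ∧ n % 4 = 3 then -t else t)) :
    CodeFP (pairE natE (pairE natE intE)) (pairE natE (pairE natE intE)) F := by
  have hA : CodeFP (pairE natE (pairE natE intE)) natE (fun st => st.1) := fst _ _
  have hN : CodeFP (pairE natE (pairE natE intE)) natE (fun st => st.2.1) := (snd _ _).fst'
  have hT : CodeFP (pairE natE (pairE natE intE)) intE (fun st => st.2.2) := (snd _ _).snd'
  have hTn : CodeFP (pairE natE (pairE natE intE)) intE (fun st => -st.2.2) := (intNeg.comp hT :)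
  have hEq : ∀ {g : ℕ × ℕ × ℤ → ℕ}, CodeFP (pairE natE (pairE natE intE)) natE g →
      ∀ m r : ℕ, CodeFP (pairE natE (pairE natE intE)) bitE (fun st => decide (g st % m = r)) :=
    fun hg m r => (natEq.comp ((natMod.comp (hg.pair (const _ m))).pair (const _ r)) :)
  have hA0 : CodeFP (pairE natE (pairE natE intE)) bitE (fun st => decide (st.1 = 0)) :=
    (natEq.comp (hA.pair (const _ (0 : ℕ))) :)
  have hHalfN : CodeFP (pairE natE (pairE natE intE)) natE (fun st => st.2.1 / 2) :=
    (natDiv.comp (hN.pair (const _ (2 : ℕ))) :)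
  have hHalfA : CodeFP (pairE natE (pairE natE intE)) natE (fun st => st.1 / 2) :=
    (natDiv.comp (hA.pair (const _ (2 : ℕ))) :)
  have hBr1 : CodeFP (pairE natE (pairE natE intE)) (pairE natE (pairE natE intE))
      (fun st => (st.1 % (st.2.1 / 2), st.2.1 / 2,
        if decide (st.1 % 2 = 0) then (0 : ℤ) else st.2.2)) :=
    ((natMod.comp (hA.pair hHalfN)).pair (hHalfN.pair ((hEq hA 2 0).ite (const _ (0 : ℤ)) hT)) :)
  have hBr2 : CodeFP (pairE natE (pairE natE intE)) (pairE natE (pairE natE intE))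
      (fun st => (st.1 / 2, st.2.1,
        if decide (st.2.1 % 8 = 3) || decide (st.2.1 % 8 = 5) then -st.2.2 else st.2.2)) :=
    (hHalfA.pair (hN.pair (((hEq hN 8 3).or (hEq hN 8 5)).ite hTn hT)) :)
  have hBr3 : CodeFP (pairE natE (pairE natE intE)) (pairE natE (pairE natE intE))
      (fun st => (st.2.1 % st.1, st.1,
        if decide (st.1 % 4 = 3) && decide (st.2.1 % 4 = 3) then -st.2.2 else st.2.2)) :=
    ((natMod.comp (hN.pair hA)).pair (hA.pair (((hEq hA 4 3).and (hEq hN 4 3)).ite hTn hT)) :)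
  refine (hA0.ite (CodeFP.id _) ((hEq hN 2 0).ite hBr1 ((hEq hA 2 0).ite hBr2 hBr3))).congr
    fun st => ?_
  obtain ⟨a, n, t⟩ := st
  simp only [Bool.or_eq_true, Bool.and_eq_true, decide_eq_true_eq, id]
  by_cases ha : a = 0
  · rw [if_pos ha, ha, h0]
  rw [if_neg ha]
  by_cases hne : n % 2 = 0
  · rw [if_pos hne, h1 a n t ha hne]
  rw [if_neg hne]
  by_cases hae : a % 2 = 0
  · rw [if_pos hae, h2 a n t ha (by omega) hae]
  · rw [if_neg hae, h3 a n t ha (by omega) (by omega)]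

/-- The initial state is computed on codes. -/
theorem codeFP_init (I : ℤ × ℕ → ℕ × ℕ × ℤ)
    (hI : I = fun q =>
      if q.2 = 0 then ((0 : ℕ), (1 : ℕ), (1 : ℤ)) else ((q.1 % q.2).toNat, q.2, 1)) :
    CodeFP (pairE intE natE) (pairE natE (pairE natE intE)) I := by
  subst hI
  have hz : CodeFP (pairE intE natE) bitE (fun q => decide (q.2 = 0)) :=
    (natEq.comp ((snd _ _).pair (const _ (0 : ℕ))) :)
  have hmod : CodeFP (pairE intE natE) intE (fun q => q.1 % (q.2 : ℤ)) :=
    (intEModOf (fst _ _) (intOfNat.comp (snd _ _)) :)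
  have hone : CodeFP (pairE intE natE) (pairE natE (pairE natE intE))
      (fun q => ((q.1 % (q.2 : ℤ)).toNat, q.2, (1 : ℤ))) :=
    ((intToNat.comp hmod).pair ((snd _ _).pair (const _ (1 : ℤ))) :)
  exact (hz.ite (const _ ((0 : ℕ), (1 : ℕ), (1 : ℤ))) hone).congr fun q => by
    simp only [decide_eq_true_eq]

/-- The answer `t` if `n = 1`, else `0`, is read off in polynomial time. -/
theorem codeFP_out : CodeFP (pairE natE (pairE natE intE)) intE
    (fun st => if st.2.1 = 1 then st.2.2 else 0) := by
  have hN : CodeFP (pairE natE (pairE natE intE)) natE (fun st => st.2.1) := (snd _ _).fst'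
  have hT : CodeFP (pairE natE (pairE natE intE)) intE (fun st => st.2.2) := (snd _ _).snd'
  exact ((natEq.comp (hN.pair (const _ (1 : ℕ)))).ite hT (const _ (0 : ℤ))).congr fun st => by
    simp only [decide_eq_true_eq]

/-- The round budget `3 · size b`, in unary. -/
theorem budget_codeFP : CodeFP (pairE intE natE) unE (fun q => 3 * Nat.size q.2) := by
  have hs : CodeFP (pairE intE natE) unE (fun q => (natE q.2).length) :=
    (strLength.comp (strOfNat.comp (snd _ _)) :)
  exact (unAdd.comp (hs.pair (unAdd.comp (hs.pair hs)))).congr fun q => by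
    simp only [CodeFP.length_natE]; ring

/-- **The Jacobi symbol is computed on codes in polynomial time**, given any implementation `F`
of the round. -/
theorem jacobiSym_codeFP_of_step (F : ℕ × ℕ × ℤ → ℕ × ℕ × ℤ)
    (h0 : ∀ (n : ℕ) (t : ℤ), F (0, n, t) = (0, n, t))
    (h1 : ∀ (a n : ℕ) (t : ℤ), a ≠ 0 → n % 2 = 0 →
      F (a, n, t) = (a % (n / 2), n / 2, if a % 2 = 0 then 0 else t))
    (h2 : ∀ (a n : ℕ) (t : ℤ), a ≠ 0 → n % 2 = 1 → a % 2 = 0 →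
      F (a, n, t) = (a / 2, n, if n % 8 = 3 ∨ n % 8 = 5 then -t else t))
    (h3 : ∀ (a n : ℕ) (t : ℤ), a ≠ 0 → n % 2 = 1 → a % 2 = 1 →
      F (a, n, t) = (n % a, a, if a % 4 = 3 ∧ n % 4 = 3 then -t else t)) :
    CodeFP (pairE intE natE) intE (fun q : ℤ × ℕ => jacobiSym q.1 q.2) := by
  -- the initial state, generalized
  obtain ⟨I, hI⟩ : ∃ I : ℤ × ℕ → ℕ × ℕ × ℤ,
      I = fun q =>
        if q.2 = 0 then ((0 : ℕ), (1 : ℕ), (1 : ℤ)) else ((q.1 % q.2).toNat, q.2, 1) :=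
    ⟨_, rfl⟩
  have hF : CodeFP (pairE (pairE intE natE) (pairE natE (pairE natE intE)))
      (pairE natE (pairE natE intE)) (fun t => F t.2) :=
    ((codeFP_step F h0 h1 h2 h3).comp (snd _ _) :)
  have hiter : CodeFP (pairE intE natE) (pairE natE (pairE natE intE))
      (fun q => F^[3 * Nat.size q.2] (I q)) :=
    (iterateInv (F := fun _ st => F st) (init := I) (k := fun q => 3 * Nat.size q.2)
      (fun q _ st => Nat.size st.1 ≤ Nat.size q.2 + 1 ∧ Nat.size st.2.1 ≤ Nat.size q.2 + 1 ∧
        st.2.2.natAbs ≤ 1) hF (codeFP_init I hI) budget_codeFP (small_init I hI)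
      (fun _ _ _ h => small_step F h0 h1 h2 h3 h) (4 * X + 16)
      (fun _ j _ h => length_le_of_small h j) :)
  refine (codeFP_out.comp hiter).congr fun q => ?_
  -- correctness of the run
  obtain ⟨a₀, n₀⟩ := q
  dsimp only
  by_cases hn0 : n₀ = 0
  · subst hn0
    rw [show I (a₀, 0) = (0, 1, 1) by rw [hI]; exact if_pos rfl, Function.iterate_fixed (h0 1 1),
      jacobiSym.zero_right]
    exact if_pos rfl
  · have hpos : (0 : ℤ) < n₀ := by exact_mod_cast Nat.pos_of_ne_zero hn0
    have e1 : 0 ≤ a₀ % n₀ := Int.emod_nonneg _ hpos.ne'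
    have e2 : a₀ % n₀ < n₀ := Int.emod_lt_of_pos _ hpos
    have ht :
        (1 : ℤ) * jacobiSym (((a₀ % n₀).toNat : ℕ) : ℤ) n₀ = jacobiSym a₀ n₀ := by
      rw [Int.toNat_of_nonneg e1, one_mul, ← jacobiSym.mod_left]
    have hpot : Nat.size (a₀ % n₀).toNat + 2 * Nat.size n₀ ≤ 3 * Nat.size n₀ := by
      have := Nat.size_le_size (show (a₀ % n₀).toNat ≤ n₀ by omega)
      omega
    obtain ⟨n, t, hs, hn, ht'⟩ :=
      iterate_spec F h0 h1 h2 h3 _ _ _ _ _ hn0 (by omega) ht hpot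
    rw [show I (a₀, n₀) = ((a₀ % n₀).toNat, n₀, 1) by rw [hI]; exact if_neg hn0, hs]
    dsimp only
    by_cases hn1 : n = 1
    · rw [if_pos hn1, ← ht', hn1, jacobiSym.one_right, mul_one]
    · rw [if_neg hn1, ← ht', jacobiSym.zero_left (by omega), mul_zero]

end JacobiCodeFP

/-- **STUB T1a · `stub_jacobiSymCodeFP`**: the Jacobi symbol `(a | b)` (`a : ℤ`, `b : ℕ`) is
computed on codes by a polynomial-time string function (binary/Euclid-type Jacobi algorithm with
`jacobiSym.mod_left`, quadratic reciprocity and the supplements; `O(log b)` rounds). -/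
theorem stub_jacobiSymCodeFP :
    Literature.Computability.Complexity.CodeFP
      (Literature.Computability.Complexity.CodeFP.pairE Literature.Computability.Complexity.CodeFP.intE
        Literature.Computability.Complexity.CodeFP.natE)
      Literature.Computability.Complexity.CodeFP.intE (fun q : ℤ × ℕ => jacobiSym q.1 q.2) :=
  JacobiCodeFP.jacobiSym_codeFP_of_step
    (fun st => if st.1 = 0 then st
      else if st.2.1 % 2 = 0 then
        (st.1 % (st.2.1 / 2), st.2.1 / 2, if st.1 % 2 = 0 then 0 else st.2.2)
      else if st.1 % 2 = 0 then
        (st.1 / 2, st.2.1, if st.2.1 % 8 = 3 ∨ st.2.1 % 8 = 5 then -st.2.2 else st.2.2)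
      else (st.2.1 % st.1, st.1, if st.1 % 4 = 3 ∧ st.2.1 % 4 = 3 then -st.2.2 else st.2.2))
    (fun n t => by simp) (fun a n t ha hn => by simp [ha, hn])
    (fun a n t ha hn hae => by simp [ha, hn, hae]) (fun a n t ha hn hae => by simp [ha, hn, hae])

end Summit.QuantumAdvantage.QuantumAdvantage.Theorems.LiouvilleNotPPoly
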